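import Summits.CriticalPhenomena.PercolationContinuityZ3.Theorems.Transplant.FKDoubleFanWedge
import Summits.CriticalPhenomena.PercolationContinuityZ3.Theorems.Transplant.FKThreeApexUCondRimStep
import HarnessLib

/-!
# Double fans `K₂ ∨ P_{m+1}`, far cross-apex pairs: the `q = 1/2` THRESHOLD of the `Valid ∧ U` input relaxation for the termwise route

Helper file (`--supports stmt-CriticalPhenomena-4575`), FK sub-lane `prim-bschramm-fk-3` (gen 31); builds on p205010 (kernel theorem, internal
audit signed; external expert review pending).  Pure real algebra, no sorries; standard axioms.  Memo `bschramm/prim-bschramm-fk-3/FAR-CROSS-VI.md` §4.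

The termwise route to cross-apex negative correlation at all distances (`…DoubleFanWedge`, `…WedgeWord`, `…SeedCone`, `…OrbitCone`) asks for a set of
bivectors stable under the polarisations `T_D, T_a, T_b`, containing every input `u ∧ P_a u` and pairing non-negatively with every target
`s ∧ P_b s`.  Every search so far described the inputs through the OUTER relaxation `{Valid q ∧ (U_a) ∧ (U_b) ∧ (U_c)}` of `InKE q`
(`…ThreeApexRimStep`, `…ThreeApexUCondRimStep`).  This file computes the exact price of that relaxation.

Along the `U_b`-tight degenerate family `u_ε = (ε, α'ε, (1−q+τ)ε, β'ε, 1)`, `β' = (1−q) + (2−q)²/(4(α' − (1−q)))`, the input bivector is, EXACTLY,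
`u_ε ∧ P_a u_ε = (ε·|u_ε|)·limRay q m + ε²·(remainder)` with `m = 1/(1+α')` (**`wedgeH_famU`**, after clearing denominators: **`famU`**,
**`limRay`** `= 4(1−(2−q)m)·(e_xv + m·e_uv) + (4(1−(2−q)m)(2−q)m + (2−q)²m²)·e_zv`).  One rim polarisation followed by one `a`-spoke
polarisation pairs the limit ray with the trivial target `δ₀ ∧ P_b δ₀` as (**`pairH_opTa_opTD_limRay`**)
  `⟪T_a T_D limRay(q,m), δ₀∧P_bδ₀⟫ = 4·Θ_q(m)`,  `Θ_q(m) = q(1−q) − (1−q)(2−q)(1+q)·m + (1−q)(2−q)²(4+q)/4·m²` (**`threshQ`**),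
whose discriminant is `(1−q)²(2−q)²·(1−2q)` (**`threshQ_sq`**: `4(4+q)Θ_q(m) = (1−q)[((2−q)(4+q)m − 2(1+q))² + 4(2q−1)]`).  Hence
* **`threshQ_nonneg`**: for `1/2 ≤ q ≤ 1` the pairing is `≥ 0` for every `m` (at `q = 1/2` it is a perfect square, tangent at `m = 4/9`);
* **`threshQ_vertex_neg`**: for `0 < q < 1/2` it is NEGATIVE at `m* = 2(1+q)/((2−q)(4+q)) ∈ (0, 1/(2−q))`;
* **`validU_witness_two_fifths`**: at `q = 2/5` the explicit vector `u = (1/100, 3/200, 2/125, 59/4500, 1)` satisfies `Valid`, `(U_a)`, `(U_b)`, `(U_c)`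
  and `⟪T_a(T_D(u ∧ P_a u)), δ₀∧P_bδ₀⟫ = −84031/67500000 < 0`; so (**`no_stable_set_through_witness`**) NO set of bivectors stable under `T_D` and `T_a`
  contains this `Valid ∧ U` input and pairs non-negatively with the trivial target.
CONSEQUENCE (memo §4): for `q < 1/2` no termwise certificate — polyhedral or curved, convex or not — can use `Valid ∧ U` as its description of
the inputs; information on `InKE` beyond `(U)` is necessary there.  For `q ≥ 1/2` this particular obstruction vanishes (numerically no word of length
`≤ 4` obstructs on the family), consistent with the `Valid ∧ U`-based programme of gens 29–30 at `q = 7/10, 9/10`.  The true inputs (`u ∈ InKE q`)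
are of course admissible for every `q` (their total Rayleigh difference is a genuine negative-correlation instance).
[cite: Grimmett2006, §3.9 eq. (3.94) (pp. 63–64)] [folklore]
-/

noncomputable section

namespace Summit.CriticalPhenomena.PercolationContinuityZ3.Theorems

namespace FK

namespace ThreeApex

/-! ### The limit ray and the threshold quadratic -/

/-- The limit ray of the `U_b`-tight degenerate `Valid ∧ U` input family at `e_xv`, denominators cleared:
`limRay q m = 4(1−(2−q)m)·e_xv + 4(1−(2−q)m)m·e_uv + (4(1−(2−q)m)(2−q)m + (2−q)²m²)·e_zv`. [folklore] -/
def limRay (q m : ℝ) : Biv :=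
  ⟨0, 0, 0, 4 * (1 - (2 - q) * m) * m, 0, 0, 4 * (1 - (2 - q) * m), 0, 0, 4 * (1 - (2 - q) * m) * (2 - q) * m + (2 - q) ^ 2 * m ^ 2⟩

/-- The threshold quadratic `Θ_q(m) = q(1−q) − (1−q)(2−q)(1+q)·m + (1−q)(2−q)²(4+q)/4·m²`. [folklore] -/
def threshQ (q m : ℝ) : ℝ :=
  q * (1 - q) - (1 - q) * (2 - q) * (1 + q) * m + (1 - q) * (2 - q) ^ 2 * (4 + q) / 4 * m ^ 2

/-- The trivial target bivector `δ₀ ∧ P_b δ₀ = (uz, uv, xz, xv, yz, yv ↦ 1; ux, uy, xy, zv ↦ 0)`. [folklore] -/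
theorem wedgeH_delta0_target : wedgeH (conv (edgeBC 0) delta0) (conv (edgeBC 1) delta0) = ⟨0, 0, 1, 1, 0, 1, 1, 1, 1, 0⟩ := by
  ext <;> simp only [wedgeH, conv, edgeBC, delta0, hx, hy, hz, V5.total] <;> ring

/-- **One rim polarisation and one `a`-spoke polarisation of the limit ray, paired with the trivial target:**
`⟪T_a T_D limRay(q,m), δ₀ ∧ P_b δ₀⟫ = 4·Θ_q(m)`. [folklore] -/
theorem pairH_opTa_opTD_limRay (q m : ℝ) :
    pairH q (opTa (opTD q (limRay q m))) (wedgeH (conv (edgeBC 0) delta0) (conv (edgeBC 1) delta0)) = 4 * threshQ q m := by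
  rw [wedgeH_delta0_target]
  simp only [pairH, opTa, opTD, limRay, threshQ]
  ring

/-- **Completed square:** `4(4+q)·Θ_q(m) = (1−q)·[((2−q)(4+q)m − 2(1+q))² + 4(2q−1)]`; the discriminant of `Θ_q` is `(1−q)²(2−q)²(1−2q)`. [folklore] -/
theorem threshQ_sq (q m : ℝ) :
    4 * (4 + q) * threshQ q m = (1 - q) * (((2 - q) * (4 + q) * m - 2 * (1 + q)) ^ 2 + 4 * (2 * q - 1)) := by
  simp only [threshQ]; ring

/-- **Above the threshold:** for `1/2 ≤ q ≤ 1` the pairing `⟪T_a T_D limRay(q,m), δ₀∧P_bδ₀⟫` is `≥ 0` for every `m`. [folklore] -/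
theorem threshQ_nonneg {q : ℝ} (hq : 1 / 2 ≤ q) (hq1 : q ≤ 1) (m : ℝ) : 0 ≤ threshQ q m := by
  have h := threshQ_sq q m
  have h1 : 0 ≤ 1 - q := by linarith
  have h2 : 0 ≤ ((2 - q) * (4 + q) * m - 2 * (1 + q)) ^ 2 + 4 * (2 * q - 1) := by nlinarith [sq_nonneg ((2 - q) * (4 + q) * m - 2 * (1 + q))]
  have h3 : 0 ≤ (1 - q) * (((2 - q) * (4 + q) * m - 2 * (1 + q)) ^ 2 + 4 * (2 * q - 1)) := mul_nonneg h1 h2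
  have h4 : 0 < 4 * (4 + q) := by linarith
  nlinarith

/-- At `q = 1/2` the threshold quadratic is a perfect square, tangent to zero at `m = 4/9`. [folklore] -/
theorem threshQ_half (m : ℝ) : threshQ (1 / 2) m = (1 / 2 - 9 / 8 * m) ^ 2 := by
  simp only [threshQ]; ring

/-- **Below the threshold:** for `0 < q < 1/2` the vertex `m* = 2(1+q)/((2−q)(4+q))` lies in `(0, 1/(2−q))` (where the family is defined and
`limRay` has non-negative `xv, uv, zv`) and `Θ_q(m*) = (1−q)(2q−1)/(4+q) < 0`. [folklore] -/
theorem threshQ_vertex_neg {q : ℝ} (hq0 : 0 < q) (hq : q < 1 / 2) :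
    0 < 2 * (1 + q) / ((2 - q) * (4 + q)) ∧ 2 * (1 + q) / ((2 - q) * (4 + q)) < 1 / (2 - q) ∧
      threshQ q (2 * (1 + q) / ((2 - q) * (4 + q))) < 0 := by
  have h2 : 0 < 2 - q := by linarith
  have h4 : 0 < 4 + q := by linarith
  have hprod : 0 < (2 - q) * (4 + q) := mul_pos h2 h4
  refine ⟨div_pos (by linarith) hprod, ?_, ?_⟩
  · have h2ne : (2 : ℝ) - q ≠ 0 := h2.ne'
    have h4ne : (4 : ℝ) + q ≠ 0 := h4.ne'
    have e : 1 / (2 - q) - 2 * (1 + q) / ((2 - q) * (4 + q)) = 1 / (4 + q) := by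
      field_simp
      ring
    have h5 : 0 < 1 / (4 + q) := by positivity
    linarith
  · have e : threshQ q (2 * (1 + q) / ((2 - q) * (4 + q))) = (1 - q) * (2 * q - 1) / (4 + q) := by
      simp only [threshQ]
      field_simp
      ring
    rw [e]
    apply div_neg_of_neg_of_pos _ h4
    nlinarith

/-! ### The approximating `Valid ∧ U` family (exact decomposition) -/

/-- The `U_b`-tight degenerate family, scaled by `4(1−(2−q)m)·m` to clear denominators (`m = 1/(1+α')`):
`(Z₀, Z_ab, Z_ac, Z_bc, Z₁) = (Dmε, D(1−m)ε, Dm(1−q+τ)ε, (Dm(1−q) + (2−q)²m²)ε, Dm)`, `D = 4(1−(2−q)m)`. [folklore] -/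
def famU (q m τ ε : ℝ) : V5 :=
  ⟨4 * (1 - (2 - q) * m) * m * ε, 4 * (1 - (2 - q) * m) * (1 - m) * ε, 4 * (1 - (2 - q) * m) * m * (1 - q + τ) * ε,
    (4 * (1 - (2 - q) * m) * m * (1 - q) + (2 - q) ^ 2 * m ^ 2) * ε, 4 * (1 - (2 - q) * m) * m⟩

/-- The `ε²`-remainder of the family's input bivector (coordinates `uy, xy, yz` only). [folklore] -/
def famRem (q m τ : ℝ) : Biv :=
  ⟨0, (4 * (1 - (2 - q) * m) * m) ^ 2 * (2 - q + τ), 0, 0, (4 * (1 - (2 - q) * m)) ^ 2 * m * (2 - q + τ), 0, 0,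
    -((4 * (1 - (2 - q) * m) * m + (4 * (1 - (2 - q) * m) * m * (1 - q) + (2 - q) ^ 2 * m ^ 2)) *
      (4 * (1 - (2 - q) * m) * m) * (2 - q + τ)), 0, 0⟩

/-- **Exact decomposition of the family's input bivector:** `u ∧ P_a u = (ε·|u|)·limRay q m + ε²·famRem`. [folklore] -/
theorem wedgeH_famU (q m τ ε : ℝ) :
    wedgeH (conv (edgeAC 0) (famU q m τ ε)) (conv (edgeAC 1) (famU q m τ ε)) =
      Biv.add (Biv.smul (ε * (famU q m τ ε).total) (limRay q m)) (Biv.smul (ε ^ 2) (famRem q m τ)) := by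
  ext <;> simp only [wedgeH, conv, edgeAC, famU, famRem, limRay, Biv.add, Biv.smul, hx, hy, hz, V5.total] <;> ring

/-- Consequently the polarised pairing along the family is `ε·(4|u|·Θ_q(m)) + ε²·(remainder pairing)`: its sign for small `ε > 0` is the sign
of `Θ_q(m)` whenever `Θ_q(m) ≠ 0`. [folklore] -/
theorem pairH_opTa_opTD_famU (q m τ ε : ℝ) :
    pairH q (opTa (opTD q (wedgeH (conv (edgeAC 0) (famU q m τ ε)) (conv (edgeAC 1) (famU q m τ ε)))))
        (wedgeH (conv (edgeBC 0) delta0) (conv (edgeBC 1) delta0)) =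
      ε * (4 * (famU q m τ ε).total * threshQ q m) +
        ε ^ 2 * pairH q (opTa (opTD q (famRem q m τ))) (wedgeH (conv (edgeBC 0) delta0) (conv (edgeBC 1) delta0)) := by
  rw [wedgeH_famU, wedgeH_delta0_target]
  simp only [pairH, opTa, opTD, limRay, threshQ, famRem, Biv.add, Biv.smul]
  ring

/-! ### An explicit witness below the threshold (`q = 2/5`) -/

/-- The witness at `q = 2/5`: the family member with `α' = 3/2` (`m = 2/5`), `τ = 1`, `ε = 1/100`, unscaled. [folklore] -/
def witnessU : V5 := ⟨1 / 100, 3 / 200, 2 / 125, 59 / 4500, 1⟩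

/-- The witness has non-negative masses. [folklore] -/
theorem witnessU_nonneg : witnessU.Nonneg := by
  refine ⟨?_, ?_, ?_, ?_, ?_⟩ <;> norm_num [witnessU]

/-- The witness is `Valid` at `q = 2/5`. [folklore] -/
theorem witnessU_valid : Valid (2 / 5) witnessU := by
  refine ⟨witnessU_nonneg, ?_, ?_, ?_, ?_, ?_, ?_, ?_⟩ <;>
    norm_num [witnessU, masterN, swapBC, swapAB, ThreeApex.lam, kap]

/-- The witness satisfies `(U_a)` at `q = 2/5` (through `Δ_U ≥ 0`). [folklore] -/
theorem witnessU_uCond : UCond (2 / 5) witnessU := by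
  refine uCond_of_disc (by norm_num) (by norm_num) witnessU_nonneg (Or.inr ?_)
  norm_num [discU, wlin, jA_eq, witnessU]

/-- The witness satisfies `(U_b)` at `q = 2/5`. [folklore] -/
theorem witnessU_uCondB : UCond (2 / 5) (swapAB witnessU) := by
  refine uCond_of_disc (by norm_num) (by norm_num) (by refine ⟨?_, ?_, ?_, ?_, ?_⟩ <;> norm_num [witnessU, swapAB]) (Or.inr ?_)
  norm_num [discU, wlin, jA_eq, witnessU, swapAB]

/-- The witness satisfies `(U_c)` at `q = 2/5`. [folklore] -/
theorem witnessU_uCondC : UCond (2 / 5) (swapAC witnessU) := by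
  refine uCond_of_disc (by norm_num) (by norm_num) (by refine ⟨?_, ?_, ?_, ?_, ?_⟩ <;> norm_num [witnessU, swapAC]) (Or.inr ?_)
  norm_num [discU, wlin, jA_eq, witnessU, swapAC]

/-- **The polarised pairing of the witness is negative:** `⟪T_a(T_D(u ∧ P_a u)), δ₀ ∧ P_b δ₀⟫ = −84031/67500000`. [folklore] -/
theorem pairH_witnessU :
    pairH (2 / 5) (opTa (opTD (2 / 5) (wedgeH (conv (edgeAC 0) witnessU) (conv (edgeAC 1) witnessU))))
        (wedgeH (conv (edgeBC 0) delta0) (conv (edgeBC 1) delta0)) = -(84031 / 67500000) := by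
  rw [wedgeH_delta0_target]
  simp only [pairH, opTa, opTD, wedgeH, conv, edgeAC, witnessU, hx, hy, hz, V5.total]
  norm_num

/-- **`Valid ∧ U` witness below the threshold** (`q = 2/5`): a vector with `Valid`, `(U_a)`, `(U_b)`, `(U_c)` whose input bivector, after one
rim polarisation and one `a`-spoke polarisation, pairs NEGATIVELY with the trivial target. [folklore] -/
theorem validU_witness_two_fifths :
    Valid (2 / 5) witnessU ∧ UCond (2 / 5) witnessU ∧ UCond (2 / 5) (swapAB witnessU) ∧ UCond (2 / 5) (swapAC witnessU) ∧
      pairH (2 / 5) (opTa (opTD (2 / 5) (wedgeH (conv (edgeAC 0) witnessU) (conv (edgeAC 1) witnessU))))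
        (wedgeH (conv (edgeBC 0) delta0) (conv (edgeBC 1) delta0)) < 0 := by
  refine ⟨witnessU_valid, witnessU_uCond, witnessU_uCondB, witnessU_uCondC, ?_⟩
  rw [pairH_witnessU]; norm_num

/-- **No `{T_D, T_a}`-stable set through a negative witness.**  If the input bivector of `u` is sent by `T_a ∘ T_D` to a bivector pairing
negatively with the target of `s`, then no set of bivectors that is mapped into itself by `T_D` and `T_a` contains `u ∧ P_a u` and pairs
non-negatively with `s ∧ P_b s` (no convexity, closedness or polyhedrality is assumed). [folklore] -/
theorem no_stable_set_through_witness {q : ℝ} {u s : V5}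
    (h : pairH q (opTa (opTD q (wedgeH (conv (edgeAC 0) u) (conv (edgeAC 1) u)))) (wedgeH (conv (edgeBC 0) s) (conv (edgeBC 1) s)) < 0) :
    ¬ ∃ K : Set Biv, (∀ β, β ∈ K → opTD q β ∈ K) ∧ (∀ β, β ∈ K → opTa β ∈ K) ∧
      wedgeH (conv (edgeAC 0) u) (conv (edgeAC 1) u) ∈ K ∧ (∀ β, β ∈ K → 0 ≤ pairH q β (wedgeH (conv (edgeBC 0) s) (conv (edgeBC 1) s))) := by
  rintro ⟨K, hD, hA, hin, hpos⟩
  have := hpos _ (hA _ (hD _ hin))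
  linarith

/-- **The `q = 2/5` instance:** no `{T_D, T_a}`-stable set of bivectors contains the input bivector of the `Valid ∧ U` witness and pairs
non-negatively with the trivial target — the `Valid ∧ U` relaxation of the inputs cannot support ANY termwise certificate at `q = 2/5`
(and, by `threshQ_vertex_neg` with `pairH_opTa_opTD_famU`, at any `q < 1/2`). [folklore] -/
theorem no_stable_set_validU_two_fifths :
    ¬ ∃ K : Set Biv, (∀ β, β ∈ K → opTD (2 / 5) β ∈ K) ∧ (∀ β, β ∈ K → opTa β ∈ K) ∧
      wedgeH (conv (edgeAC 0) witnessU) (conv (edgeAC 1) witnessU) ∈ K ∧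
        (∀ β, β ∈ K → 0 ≤ pairH (2 / 5) β (wedgeH (conv (edgeBC 0) delta0) (conv (edgeBC 1) delta0))) :=
  no_stable_set_through_witness validU_witness_two_fifths.2.2.2.2

end ThreeApex

end FK

end Summit.CriticalPhenomena.PercolationContinuityZ3.Theorems
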